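import Summits.KontsevichZagierPeriods.KontsevichZagierPeriods.Theorems.LiftingCriteriaDilationTransferOfTameStokes

/-!
# The rescaled pencil integrand of crux `DilationTransfer` (stmt-KontsevichZagierPeriods-3572, RESHAPE 4, II): regularity toolkit

Support file for crux `DilationTransfer`
(`Summit.KontsevichZagierPeriods.KontsevichZagierPeriods.Theses.LiftingCriteria.DilationTransfer`,
route `LiftingCriteria`, line `birth`). With all integrands on one cube `[0,1]^N` (`nᵢ, dⱼ ≤ N`) and
the parameter rescaled, `ϖ = ϖ₀ s`, the RESCALED PENCIL INTEGRAND is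
`P(w) = m₀ + Σ mᵢ gᵢ(ϖ₀w_N·πᵢw) − (ϖ₀w_N − ϖ₀)(μ₀(ϖ₀w_N) + Σ μⱼ(ϖ₀w_N) Gⱼ(ϖ₀w_N·π'ⱼw))`,
`w = (x, s) ∈ ℝ^{N+1}`. No definition is introduced: every lemma takes an abstract `P` with the
hypothesis `hP : ∀ w, P w = …`. This file proves what every attack on the pencil needs:

* the rescaled dilated argument `w ↦ (c·w_N) • (w₁,…,wₙ)` is analytic, continuous, polynomial
  (`ℚ`-semialgebraic map, semialgebraic preimages) and maps the cube to the cube for `0 ≤ c ≤ 1`;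
* the natural neighbourhood of the pencil — the preimage of the `Uᵢ`, `Vⱼ` — is open,
  `ℚ`-semialgebraic and contains `[0,1]^{N+1}` (`isOpen_pencilNhd`, `isSemialgebraic_pencilNhd`,
  `cube_subset_pencilNhd`);
* `P` is real-analytic and `ℚ`-semialgebraic there (`pencil_analyticAt`,
  `pencil_isSemialgebraicFunOn`), i.e. Nash near the closed cube;
* the two ends of the parameter interval: `P(x,1) = f₀(x) = m₀ + Σ mᵢ gᵢ(ϖ₀·πᵢx)`
  (`pencil_snoc_one`) and `P(x,0) = 0` identically (`pencil_snoc_zero`) — the latter because the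
  functional relation holds at `ϖ = 0`, where every dilation integral `∫_{[0,1]ᵏ} h(0·z)dz` is the
  value `h 0` (`setIntegral_pi_zero_smul`).

## References
* M. Kontsevich, D. Zagier, *Periods* (2001), §1.2.
* J. Bochnak, M. Coste, M.-F. Roy, *Real Algebraic Geometry* (1998), §2.2.
-/

noncomputable section

open scoped BigOperators
open MeasureTheory Set Filter
open Literature.NumberTheory.Transcendental
open Literature.ModelTheory.ExponentialFields (IsSemialgebraic)

namespace Summit.KontsevichZagierPeriods.LiftingCriteria.DilationTransfer

/-! ### Toolkit: the rescaled dilated argument `w ↦ (c·w_N) • (w₁,…,wₙ)` -/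

/-- The rescaled dilated argument of the pencil, `w ↦ (c · w_last) • (l ↦ w (castSucc (castLE h l)))`,
is real-analytic. [folklore] -/
theorem analyticAt_scaledDilate {N n : ℕ} (h : n ≤ N) (c : ℝ) (w : Fin (N + 1) → ℝ) :
    AnalyticAt ℝ (fun v : Fin (N + 1) → ℝ =>
      (c * v (Fin.last N)) • (fun l : Fin n => v (Fin.castSucc (Fin.castLE h l)))) w :=
  (analyticAt_const.mul (analyticAt_apply (Fin.last N) w)).fun_smul
    (analyticAt_reindex (fun l : Fin n => Fin.castSucc (Fin.castLE h l)) w)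

/-- The rescaled dilated argument is continuous. [folklore] -/
theorem continuous_scaledDilate {N n : ℕ} (h : n ≤ N) (c : ℝ) :
    Continuous (fun v : Fin (N + 1) → ℝ =>
      (c * v (Fin.last N)) • (fun l : Fin n => v (Fin.castSucc (Fin.castLE h l)))) :=
  (continuous_const.mul (continuous_apply (Fin.last N))).smul
    (continuous_pi fun l => continuous_apply (Fin.castSucc (Fin.castLE h l)))

/-- For `0 ≤ c ≤ 1` the rescaled dilated argument maps the cube `[0,1]^{N+1}` into the cube `[0,1]ⁿ`.
[folklore] -/
theorem scaledDilate_mem_cube {N n : ℕ} (h : n ≤ N) {c : ℝ} (hc0 : 0 ≤ c) (hc1 : c ≤ 1)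
    {w : Fin (N + 1) → ℝ} (hw : w ∈ KZ.cube (N + 1)) :
    (c * w (Fin.last N)) • (fun l : Fin n => w (Fin.castSucc (Fin.castLE h l))) ∈ KZ.cube n := by
  intro l
  have hl := KZ.mem_cube.1 hw (Fin.castSucc (Fin.castLE h l))
  have hN := KZ.mem_cube.1 hw (Fin.last N)
  simp only [Pi.smul_apply, smul_eq_mul]
  exact ⟨mul_nonneg (mul_nonneg hc0 hN.1) hl.1,
    mul_le_one₀ (mul_le_one₀ hc1 hN.1 hN.2) hl.1 hl.2⟩

/-- The rescaled dilated argument (rational scale) is a `ℚ`-semialgebraic map on every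
`ℚ`-semialgebraic set (its coordinates are polynomials). [cite: BochnakCosteRoy1998, §2.2] -/
theorem isSemialgebraicMapOn_scaledDilate {N n : ℕ} (h : n ≤ N) (c : ℚ) {s : Set (Fin (N + 1) → ℝ)}
    (hs : IsSemialgebraic ℚ s) :
    IsSemialgebraicMapOn ℚ s (fun v : Fin (N + 1) → ℝ =>
      ((c : ℝ) * v (Fin.last N)) • (fun l : Fin n => v (Fin.castSucc (Fin.castLE h l)))) :=
  IsSemialgebraicMapOn.of_forall hs fun l =>
    (((isSemialgebraicFunOn_const_ratCast hs c).fun_mul (isSemialgebraicFunOn_apply hs (Fin.last N))).fun_mul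
      (isSemialgebraicFunOn_apply hs (Fin.castSucc (Fin.castLE h l)))).congr fun v _ => by
        simp [Pi.smul_apply, smul_eq_mul]

/-- The preimage of a `ℚ`-semialgebraic set under the rescaled dilated argument (rational scale) is
`ℚ`-semialgebraic (substitution of polynomials). [cite: BochnakCosteRoy1998, §2.1] -/
theorem isSemialgebraic_preimage_scaledDilate {N n : ℕ} (h : n ≤ N) (c : ℚ) {t : Set (Fin n → ℝ)}
    (ht : IsSemialgebraic ℚ t) :
    IsSemialgebraic ℚ ((fun v : Fin (N + 1) → ℝ =>
      ((c : ℝ) * v (Fin.last N)) • (fun l : Fin n => v (Fin.castSucc (Fin.castLE h l)))) ⁻¹' t) := by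
  have key := ht.preimage_aeval (R := ℝ) (fun l : Fin n =>
    (MvPolynomial.C c * MvPolynomial.X (Fin.last N) * MvPolynomial.X (Fin.castSucc (Fin.castLE h l)) :
      MvPolynomial (Fin (N + 1)) ℚ))
  convert key using 2
  funext v
  ext l
  simp [Pi.smul_apply, smul_eq_mul]

/-- A real polynomial with real-algebraic coefficients, evaluated at a rational multiple of the last
coordinate, is a `ℚ`-semialgebraic function on every `ℚ`-semialgebraic set.
[cite: BochnakCosteRoy1998, §2.2] -/
theorem isSemialgebraicFunOn_eval_mul_last {N : ℕ} {s : Set (Fin (N + 1) → ℝ)} (hs : IsSemialgebraic ℚ s)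
    {q : Polynomial ℝ} (hq : ∀ k, IsAlgebraic ℚ (q.coeff k)) (c : ℚ) :
    IsSemialgebraicFunOn ℚ s (fun v : Fin (N + 1) → ℝ => q.eval ((c : ℝ) * v (Fin.last N))) := by
  have h : IsSemialgebraicFunOn ℚ s fun v : Fin (N + 1) → ℝ =>
      ∑ k ∈ Finset.range (q.natDegree + 1), q.coeff k * ((c : ℝ) * v (Fin.last N)) ^ k :=
    IsSemialgebraicFunOn.fun_finsetSum _ hs fun k _ =>
      (isSemialgebraicFunOn_const_of_isAlgebraic hs (hq k)).fun_mul
        (((isSemialgebraicFunOn_const_ratCast hs c).fun_mul (isSemialgebraicFunOn_apply hs (Fin.last N))).fun_pow k)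
  exact h.congr fun v _ => (Polynomial.eval_eq_sum_range' (Nat.lt_succ_self _) _).symm

/-- A real polynomial evaluated at a multiple of the last coordinate is real-analytic. [folklore] -/
theorem analyticAt_eval_mul_last {N : ℕ} (q : Polynomial ℝ) (c : ℝ) (w : Fin (N + 1) → ℝ) :
    AnalyticAt ℝ (fun v : Fin (N + 1) → ℝ => q.eval (c * v (Fin.last N))) w := by
  have h1 : AnalyticAt ℝ (fun v : Fin (N + 1) → ℝ => c * v (Fin.last N)) w :=
    analyticAt_const.fun_mul (analyticAt_apply (Fin.last N) w)
  have h := h1.aeval_polynomial q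
  simpa only [Polynomial.coe_aeval_eq_eval] using h

/-- The dilation integral at the parameter `0` is the value at the origin: `∫_{[0,1]ᵏ} h(0·z) dz = h 0`
(the cube has volume one). [folklore] -/
theorem setIntegral_pi_zero_smul {k : ℕ} (h : (Fin k → ℝ) → ℝ) :
    (∫ z in Set.pi Set.univ (fun _ : Fin k => Set.Icc (0:ℝ) 1), h ((0:ℝ) • z)) = h 0 := by
  simp only [zero_smul]
  rw [setIntegral_const, ← KZ.cube_eq_pi, KZ.volume_real_cube, one_smul]

/-! ### The natural neighbourhood of the rescaled pencil: preimages of the `Uᵢ`, `Vⱼ` -/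

/-- The set of points whose rescaled dilated arguments land in the given open sets is open.
[folklore] -/
theorem isOpen_pencilNhd {S T N : ℕ} {n : Fin S → ℕ} {d : Fin T → ℕ}
    {U : (i : Fin S) → Set (Fin (n i) → ℝ)} {V : (j : Fin T) → Set (Fin (d j) → ℝ)}
    (hU : ∀ i, IsOpen (U i)) (hV : ∀ j, IsOpen (V j)) (c : ℝ) (hn : ∀ i, n i ≤ N) (hd : ∀ j, d j ≤ N) :
    IsOpen {w : Fin (N + 1) → ℝ |
      (∀ i, (c * w (Fin.last N)) • (fun l : Fin (n i) => w (Fin.castSucc (Fin.castLE (hn i) l))) ∈ U i) ∧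
      ∀ j, (c * w (Fin.last N)) • (fun l : Fin (d j) => w (Fin.castSucc (Fin.castLE (hd j) l))) ∈ V j} := by
  have e : {w : Fin (N + 1) → ℝ |
      (∀ i, (c * w (Fin.last N)) • (fun l : Fin (n i) => w (Fin.castSucc (Fin.castLE (hn i) l))) ∈ U i) ∧
      ∀ j, (c * w (Fin.last N)) • (fun l : Fin (d j) => w (Fin.castSucc (Fin.castLE (hd j) l))) ∈ V j} =
      (⋂ i, (fun w : Fin (N + 1) → ℝ =>
        (c * w (Fin.last N)) • (fun l : Fin (n i) => w (Fin.castSucc (Fin.castLE (hn i) l)))) ⁻¹' U i) ∩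
      ⋂ j, (fun w : Fin (N + 1) → ℝ =>
        (c * w (Fin.last N)) • (fun l : Fin (d j) => w (Fin.castSucc (Fin.castLE (hd j) l)))) ⁻¹' V j := by
    ext w; simp
  rw [e]
  exact (isOpen_iInter_of_finite fun i => (hU i).preimage (continuous_scaledDilate (hn i) c)).inter
    (isOpen_iInter_of_finite fun j => (hV j).preimage (continuous_scaledDilate (hd j) c))

/-- The set of points whose rescaled dilated arguments (rational scale) land in given
`ℚ`-semialgebraic sets is `ℚ`-semialgebraic. [cite: BochnakCosteRoy1998, §2.1] -/
theorem isSemialgebraic_pencilNhd {S T N : ℕ} {n : Fin S → ℕ} {d : Fin T → ℕ}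
    {U : (i : Fin S) → Set (Fin (n i) → ℝ)} {V : (j : Fin T) → Set (Fin (d j) → ℝ)}
    (hU : ∀ i, IsSemialgebraic ℚ (U i)) (hV : ∀ j, IsSemialgebraic ℚ (V j)) (c : ℚ)
    (hn : ∀ i, n i ≤ N) (hd : ∀ j, d j ≤ N) :
    IsSemialgebraic ℚ {w : Fin (N + 1) → ℝ |
      (∀ i, ((c : ℝ) * w (Fin.last N)) • (fun l : Fin (n i) => w (Fin.castSucc (Fin.castLE (hn i) l))) ∈ U i) ∧
      ∀ j, ((c : ℝ) * w (Fin.last N)) • (fun l : Fin (d j) => w (Fin.castSucc (Fin.castLE (hd j) l))) ∈ V j} := by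
  have h1 := IsSemialgebraic.biInter Finset.univ (fun i => (fun w : Fin (N + 1) → ℝ =>
      ((c : ℝ) * w (Fin.last N)) • (fun l : Fin (n i) => w (Fin.castSucc (Fin.castLE (hn i) l)))) ⁻¹' U i)
    fun i _ => isSemialgebraic_preimage_scaledDilate (hn i) c (hU i)
  have h2 := IsSemialgebraic.biInter Finset.univ (fun j => (fun w : Fin (N + 1) → ℝ =>
      ((c : ℝ) * w (Fin.last N)) • (fun l : Fin (d j) => w (Fin.castSucc (Fin.castLE (hd j) l)))) ⁻¹' V j)
    fun j _ => isSemialgebraic_preimage_scaledDilate (hd j) c (hV j)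
  convert h1.inter h2 using 1
  ext w; simp

/-- For a scale `0 ≤ c ≤ 1` the closed cube `[0,1]^{N+1}` lies in the pencil neighbourhood as soon as
the targets contain the closed cubes. [folklore] -/
theorem cube_subset_pencilNhd {S T N : ℕ} {n : Fin S → ℕ} {d : Fin T → ℕ}
    {U : (i : Fin S) → Set (Fin (n i) → ℝ)} {V : (j : Fin T) → Set (Fin (d j) → ℝ)}
    (hU : ∀ i, Set.pi Set.univ (fun _ : Fin (n i) => Set.Icc (0:ℝ) 1) ⊆ U i)
    (hV : ∀ j, Set.pi Set.univ (fun _ : Fin (d j) => Set.Icc (0:ℝ) 1) ⊆ V j)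
    {c : ℝ} (hc0 : 0 ≤ c) (hc1 : c ≤ 1) (hn : ∀ i, n i ≤ N) (hd : ∀ j, d j ≤ N) :
    KZ.cube (N + 1) ⊆ {w : Fin (N + 1) → ℝ |
      (∀ i, (c * w (Fin.last N)) • (fun l : Fin (n i) => w (Fin.castSucc (Fin.castLE (hn i) l))) ∈ U i) ∧
      ∀ j, (c * w (Fin.last N)) • (fun l : Fin (d j) => w (Fin.castSucc (Fin.castLE (hd j) l))) ∈ V j} := by
  intro w hw
  refine ⟨fun i => hU i ?_, fun j => hV j ?_⟩
  · rw [← KZ.cube_eq_pi]; exact scaledDilate_mem_cube (hn i) hc0 hc1 hw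
  · rw [← KZ.cube_eq_pi]; exact scaledDilate_mem_cube (hd j) hc0 hc1 hw

/-! ### The rescaled pencil integrand: regularity and the two ends of the parameter interval -/

/-- **The rescaled pencil integrand is real-analytic on the pencil neighbourhood.**
`P(w) = m₀ + Σ mᵢ gᵢ(ϖ₀w_N·πᵢw) − (ϖ₀w_N − ϖ₀)(μ₀(ϖ₀w_N) + Σ μⱼ(ϖ₀w_N) Gⱼ(ϖ₀w_N·π'ⱼw))` is analytic
at every point whose rescaled dilated arguments lie in the sets where the `gᵢ`, `Gⱼ` are analytic.
[folklore] -/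
theorem pencil_analyticAt {S T N : ℕ} {n : Fin S → ℕ} {d : Fin T → ℕ}
    {g : (i : Fin S) → (Fin (n i) → ℝ) → ℝ} {U : (i : Fin S) → Set (Fin (n i) → ℝ)}
    {G : (j : Fin T) → (Fin (d j) → ℝ) → ℝ} {V : (j : Fin T) → Set (Fin (d j) → ℝ)}
    (hga : ∀ i, AnalyticOnNhd ℝ (g i) (U i)) (hGa : ∀ j, AnalyticOnNhd ℝ (G j) (V j))
    {m : Fin S → ℤ} {m₀ : ℤ} {ϖ₀ : ℚ} {μ : Fin T → Polynomial ℝ} {μ₀ : Polynomial ℝ}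
    (hn : ∀ i, n i ≤ N) (hd : ∀ j, d j ≤ N) {P : (Fin (N + 1) → ℝ) → ℝ}
    (hP : ∀ w, P w = (m₀ : ℝ) + ∑ i, (m i : ℝ) * g i (((ϖ₀ : ℝ) * w (Fin.last N)) • (fun l : Fin (n i) => w (Fin.castSucc (Fin.castLE (hn i) l)))) - ((ϖ₀ : ℝ) * w (Fin.last N) - (ϖ₀ : ℝ)) * (μ₀.eval ((ϖ₀ : ℝ) * w (Fin.last N)) + ∑ j, (μ j).eval ((ϖ₀ : ℝ) * w (Fin.last N)) * G j (((ϖ₀ : ℝ) * w (Fin.last N)) • (fun l : Fin (d j) => w (Fin.castSucc (Fin.castLE (hd j) l))))))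
    {w : Fin (N + 1) → ℝ}
    (hwU : ∀ i, ((ϖ₀ : ℝ) * w (Fin.last N)) • (fun l : Fin (n i) => w (Fin.castSucc (Fin.castLE (hn i) l))) ∈ U i)
    (hwV : ∀ j, ((ϖ₀ : ℝ) * w (Fin.last N)) • (fun l : Fin (d j) => w (Fin.castSucc (Fin.castLE (hd j) l))) ∈ V j) :
    AnalyticAt ℝ P w := by
  rw [show P = _ from funext hP]
  have hA : ∀ i, AnalyticAt ℝ (fun v : Fin (N + 1) → ℝ => (m i : ℝ) *
      g i (((ϖ₀ : ℝ) * v (Fin.last N)) • (fun l : Fin (n i) => v (Fin.castSucc (Fin.castLE (hn i) l))))) w :=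
    fun i => analyticAt_const.fun_mul
      (((hga i) _ (hwU i)).fun_comp_of_eq (analyticAt_scaledDilate (hn i) (ϖ₀ : ℝ) w) rfl)
  have hB : ∀ j, AnalyticAt ℝ (fun v : Fin (N + 1) → ℝ => (μ j).eval ((ϖ₀ : ℝ) * v (Fin.last N)) *
      G j (((ϖ₀ : ℝ) * v (Fin.last N)) • (fun l : Fin (d j) => v (Fin.castSucc (Fin.castLE (hd j) l))))) w :=
    fun j => (analyticAt_eval_mul_last (μ j) (ϖ₀ : ℝ) w).fun_mul
      (((hGa j) _ (hwV j)).fun_comp_of_eq (analyticAt_scaledDilate (hd j) (ϖ₀ : ℝ) w) rfl)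
  have hsumA := Finset.univ.analyticAt_fun_sum fun i _ => hA i
  have hsumB := Finset.univ.analyticAt_fun_sum fun j _ => hB j
  exact (analyticAt_const.fun_add hsumA).fun_sub
    (((analyticAt_const.fun_mul (analyticAt_apply (Fin.last N) w)).fun_sub analyticAt_const).fun_mul
      ((analyticAt_eval_mul_last μ₀ (ϖ₀ : ℝ) w).fun_add hsumB))

/-- **The rescaled pencil integrand is `ℚ`-semialgebraic on the pencil neighbourhood** (compositions
of the `ℚ`-semialgebraic `gᵢ`, `Gⱼ` with polynomial maps, polynomials `μ` with real-algebraic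
coefficients). [cite: BochnakCosteRoy1998, Prop. 2.2.6] -/
theorem pencil_isSemialgebraicFunOn {S T N : ℕ} {n : Fin S → ℕ} {d : Fin T → ℕ}
    {g : (i : Fin S) → (Fin (n i) → ℝ) → ℝ} {U : (i : Fin S) → Set (Fin (n i) → ℝ)}
    {G : (j : Fin T) → (Fin (d j) → ℝ) → ℝ} {V : (j : Fin T) → Set (Fin (d j) → ℝ)}
    (hgs : ∀ i, IsSemialgebraicFunOn ℚ (U i) (g i)) (hGs : ∀ j, IsSemialgebraicFunOn ℚ (V j) (G j))
    {m : Fin S → ℤ} {m₀ : ℤ} {ϖ₀ : ℚ} {μ : Fin T → Polynomial ℝ} {μ₀ : Polynomial ℝ}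
    (hμ : ∀ j k, IsAlgebraic ℚ ((μ j).coeff k)) (hμ₀ : ∀ k, IsAlgebraic ℚ (μ₀.coeff k))
    (hn : ∀ i, n i ≤ N) (hd : ∀ j, d j ≤ N) {P : (Fin (N + 1) → ℝ) → ℝ}
    (hP : ∀ w, P w = (m₀ : ℝ) + ∑ i, (m i : ℝ) * g i (((ϖ₀ : ℝ) * w (Fin.last N)) • (fun l : Fin (n i) => w (Fin.castSucc (Fin.castLE (hn i) l)))) - ((ϖ₀ : ℝ) * w (Fin.last N) - (ϖ₀ : ℝ)) * (μ₀.eval ((ϖ₀ : ℝ) * w (Fin.last N)) + ∑ j, (μ j).eval ((ϖ₀ : ℝ) * w (Fin.last N)) * G j (((ϖ₀ : ℝ) * w (Fin.last N)) • (fun l : Fin (d j) => w (Fin.castSucc (Fin.castLE (hd j) l)))))) :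
    IsSemialgebraicFunOn ℚ {w : Fin (N + 1) → ℝ |
      (∀ i, ((ϖ₀ : ℝ) * w (Fin.last N)) • (fun l : Fin (n i) => w (Fin.castSucc (Fin.castLE (hn i) l))) ∈ U i) ∧
      ∀ j, ((ϖ₀ : ℝ) * w (Fin.last N)) • (fun l : Fin (d j) => w (Fin.castSucc (Fin.castLE (hd j) l))) ∈ V j} P := by
  set W := {w : Fin (N + 1) → ℝ |
      (∀ i, ((ϖ₀ : ℝ) * w (Fin.last N)) • (fun l : Fin (n i) => w (Fin.castSucc (Fin.castLE (hn i) l))) ∈ U i) ∧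
      ∀ j, ((ϖ₀ : ℝ) * w (Fin.last N)) • (fun l : Fin (d j) => w (Fin.castSucc (Fin.castLE (hd j) l))) ∈ V j}
    with hW
  have hWs : IsSemialgebraic ℚ W :=
    isSemialgebraic_pencilNhd (fun i => IsSemialgebraicFunOn.isSemialgebraic_holds (hgs i))
      (fun j => IsSemialgebraicFunOn.isSemialgebraic_holds (hGs j)) ϖ₀ hn hd
  have hA : ∀ i ∈ (Finset.univ : Finset (Fin S)), IsSemialgebraicFunOn ℚ W (fun v : Fin (N + 1) → ℝ =>
      (m i : ℝ) * g i (((ϖ₀ : ℝ) * v (Fin.last N)) • (fun l : Fin (n i) => v (Fin.castSucc (Fin.castLE (hn i) l))))) :=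
    fun i _ => (isSemialgebraicFunOn_const_intCast hWs (m i)).fun_mul
      (IsSemialgebraicFunOn.comp_isSemialgebraicMapOn_holds (hgs i)
        (isSemialgebraicMapOn_scaledDilate (hn i) ϖ₀ hWs) fun w hw => hw.1 i)
  have hB : ∀ j ∈ (Finset.univ : Finset (Fin T)), IsSemialgebraicFunOn ℚ W (fun v : Fin (N + 1) → ℝ =>
      (μ j).eval ((ϖ₀ : ℝ) * v (Fin.last N)) *
        G j (((ϖ₀ : ℝ) * v (Fin.last N)) • (fun l : Fin (d j) => v (Fin.castSucc (Fin.castLE (hd j) l))))) :=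
    fun j _ => (isSemialgebraicFunOn_eval_mul_last hWs (hμ j) ϖ₀).fun_mul
      (IsSemialgebraicFunOn.comp_isSemialgebraicMapOn_holds (hGs j)
        (isSemialgebraicMapOn_scaledDilate (hd j) ϖ₀ hWs) fun w hw => hw.2 j)
  have h := ((isSemialgebraicFunOn_const_intCast hWs m₀).fun_add
    (IsSemialgebraicFunOn.fun_finsetSum Finset.univ hWs hA)).fun_sub
    ((((isSemialgebraicFunOn_const_ratCast hWs ϖ₀).fun_mul (isSemialgebraicFunOn_apply hWs (Fin.last N))).fun_sub
      (isSemialgebraicFunOn_const_ratCast hWs ϖ₀)).fun_mul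
      ((isSemialgebraicFunOn_eval_mul_last hWs hμ₀ ϖ₀).fun_add
        (IsSemialgebraicFunOn.fun_finsetSum Finset.univ hWs hB)))
  exact h.congr fun w _ => (hP w).symm

/-- **The rescaled pencil integrand at `s = 1` is the specialised integrand `f₀ ∘ π`.** [folklore] -/
theorem pencil_snoc_one {S T N : ℕ} {n : Fin S → ℕ} {d : Fin T → ℕ}
    {g : (i : Fin S) → (Fin (n i) → ℝ) → ℝ} {G : (j : Fin T) → (Fin (d j) → ℝ) → ℝ}
    {m : Fin S → ℤ} {m₀ : ℤ} {ϖ₀ : ℚ} {μ : Fin T → Polynomial ℝ} {μ₀ : Polynomial ℝ}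
    (hn : ∀ i, n i ≤ N) (hd : ∀ j, d j ≤ N) {P : (Fin (N + 1) → ℝ) → ℝ}
    (hP : ∀ w, P w = (m₀ : ℝ) + ∑ i, (m i : ℝ) * g i (((ϖ₀ : ℝ) * w (Fin.last N)) • (fun l : Fin (n i) => w (Fin.castSucc (Fin.castLE (hn i) l)))) - ((ϖ₀ : ℝ) * w (Fin.last N) - (ϖ₀ : ℝ)) * (μ₀.eval ((ϖ₀ : ℝ) * w (Fin.last N)) + ∑ j, (μ j).eval ((ϖ₀ : ℝ) * w (Fin.last N)) * G j (((ϖ₀ : ℝ) * w (Fin.last N)) • (fun l : Fin (d j) => w (Fin.castSucc (Fin.castLE (hd j) l))))))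
    (x : Fin N → ℝ) :
    P (Fin.snoc x 1) = (m₀ : ℝ) + ∑ i, (m i : ℝ) * g i ((ϖ₀ : ℝ) • (fun l : Fin (n i) => x (Fin.castLE (hn i) l))) := by
  rw [hP]
  simp only [Fin.snoc_last, Fin.snoc_castSucc, mul_one, sub_self, zero_mul, sub_zero]

/-- **The rescaled pencil integrand vanishes identically at `s = 0`**, because the functional
relation holds at `ϖ = 0`, where every dilation integral `∫_{[0,1]ᵏ} h(0·z)dz` is the value `h 0`:
`m₀ + Σ mᵢ gᵢ(0) = −ϖ₀ (μ₀(0) + Σ μⱼ(0) Gⱼ(0))`. [cite: KontsevichZagier2001, §1.2] -/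
theorem pencil_snoc_zero {S T N : ℕ} {n : Fin S → ℕ} {d : Fin T → ℕ}
    {g : (i : Fin S) → (Fin (n i) → ℝ) → ℝ} {G : (j : Fin T) → (Fin (d j) → ℝ) → ℝ}
    {m : Fin S → ℤ} {m₀ : ℤ} {ϖ₀ : ℚ} {μ : Fin T → Polynomial ℝ} {μ₀ : Polynomial ℝ}
    (hrel0 : (m₀ : ℝ) + ∑ i, (m i : ℝ) * (∫ z in Set.pi Set.univ (fun _ : Fin (n i) => Set.Icc (0:ℝ) 1), g i ((0:ℝ) • z)) = ((0:ℝ) - (ϖ₀ : ℝ)) * (μ₀.eval 0 + ∑ j, (μ j).eval 0 * (∫ z in Set.pi Set.univ (fun _ : Fin (d j) => Set.Icc (0:ℝ) 1), G j ((0:ℝ) • z))))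
    (hn : ∀ i, n i ≤ N) (hd : ∀ j, d j ≤ N) {P : (Fin (N + 1) → ℝ) → ℝ}
    (hP : ∀ w, P w = (m₀ : ℝ) + ∑ i, (m i : ℝ) * g i (((ϖ₀ : ℝ) * w (Fin.last N)) • (fun l : Fin (n i) => w (Fin.castSucc (Fin.castLE (hn i) l)))) - ((ϖ₀ : ℝ) * w (Fin.last N) - (ϖ₀ : ℝ)) * (μ₀.eval ((ϖ₀ : ℝ) * w (Fin.last N)) + ∑ j, (μ j).eval ((ϖ₀ : ℝ) * w (Fin.last N)) * G j (((ϖ₀ : ℝ) * w (Fin.last N)) • (fun l : Fin (d j) => w (Fin.castSucc (Fin.castLE (hd j) l))))))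
    (x : Fin N → ℝ) : P (Fin.snoc x 0) = 0 := by
  simp only [setIntegral_pi_zero_smul] at hrel0
  rw [hP]
  simp only [Fin.snoc_last, mul_zero, zero_smul, zero_sub]
  rw [hrel0]
  ring

/-- **The rescaled pencil integrand vanishes identically at the parameter `s = 0`** (closed form of
`pencil_snoc_zero`, for every datum of the crux and every functional-relation witness): the relation
at `ϖ = 0` reads `m₀ + Σ mᵢ gᵢ(0) = −ϖ₀ (μ₀(0) + Σ μⱼ(0) Gⱼ(0))`. This is what makes Newton–Leibniz in
the parameter start from zero. [cite: KontsevichZagier2001, §1.2] -/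
theorem pencil_eq_zero_at_zero :
    ∀ (S : ℕ) (n : Fin S → ℕ) (g : (i : Fin S) → (Fin (n i) → ℝ) → ℝ) (m : Fin S → ℤ) (m₀ : ℤ) (ϖ₀ : ℚ) (T : ℕ) (d : Fin T → ℕ) (G : (j : Fin T) → (Fin (d j) → ℝ) → ℝ) (μ : Fin T → Polynomial ℝ) (μ₀ : Polynomial ℝ), (∀ ϖ ∈ Set.Icc (0:ℝ) 1, (m₀ : ℝ) + ∑ i, (m i : ℝ) * (∫ z in Set.pi Set.univ (fun _ : Fin (n i) => Set.Icc (0:ℝ) 1), g i (ϖ • z)) = (ϖ - (ϖ₀ : ℝ)) * (μ₀.eval ϖ + ∑ j, (μ j).eval ϖ * (∫ z in Set.pi Set.univ (fun _ : Fin (d j) => Set.Icc (0:ℝ) 1), G j (ϖ • z)))) → ∀ (N : ℕ) (hn : ∀ i, n i ≤ N) (hd : ∀ j, d j ≤ N) (x : Fin N → ℝ), (fun w : Fin (N + 1) → ℝ => (m₀ : ℝ) + ∑ i, (m i : ℝ) * g i (((ϖ₀ : ℝ) * w (Fin.last N)) • (fun l : Fin (n i) => w (Fin.castSucc (Fin.castLE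 (hn i) l)))) - ((ϖ₀ : ℝ) * w (Fin.last N) - (ϖ₀ : ℝ)) * (μ₀.eval ((ϖ₀ : ℝ) * w (Fin.last N)) + ∑ j, (μ j).eval ((ϖ₀ : ℝ) * w (Fin.last N)) * G j (((ϖ₀ : ℝ) * w (Fin.last N)) • (fun l : Fin (d j) => w (Fin.castSucc (Fin.castLE (hd j) l)))))) (Fin.snoc x 0) = 0 := by
  intro S n g m m₀ ϖ₀ T d G μ μ₀ hrel N hn hd x
  exact pencil_snoc_zero (by simpa only [zero_sub] using hrel 0 ⟨le_rfl, zero_le_one⟩) hn hd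
    (fun w => rfl) x

end Summit.KontsevichZagierPeriods.LiftingCriteria.DilationTransfer
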